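import Summits.CriticalPhenomena.SAWScalingLimit.Theses.SAWBrickWallHomotopy
import Summits.CriticalPhenomena.SAWScalingLimit.Theorems.SAWDevelopingMapHexTransferLinearPinning
import Summits.CriticalPhenomena.SAWScalingLimit.Theorems.SAWDevelopingMapHexTransferConjugateRotationCovariance
import Summits.CriticalPhenomena.SAWScalingLimit.Theorems.SAWDevelopingMapHexTransferSimilarityIdentification
import Literature.Probability.RandomPlanarGeometry.LocalMartingaleProofs
import HarnessLib

/-!
# Route SAWBrickWallHomotopy — the Assembly (item stmt-CriticalPhenomena-10313), proved

By-product of line `pin-the-shear` of the crux `HexTransfer` (stmt-CriticalPhenomena-14221): the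
three landed stubs `stub_conjugateRotationCovariance` (p96518), `stub_linearPinning` (p96403) and
`stub_similarityIdentification` (p96344) are exactly the GL₂⁺ form of the Assembly of route
SAWBrickWallHomotopy, whose linear map is DIAGONAL. Hence

`Assembly : HexConjecture → ModulusUniversality → StretchRigidity → QuarterTurnCovariance → SAWScalingLimit`

is a theorem: take the diagonal `Φ = diag(r₁, r₂)` of `ModulusUniversality`; the hexagonal limit of
`Φ⁻¹(D)` (HexConjecture) and the asymptotic equality of laws give the image limit "the `δℤ²` SAW law
of `D` converges to `Φ ∘ Γ`, `Γ` SLE(8/3) in `Φ⁻¹(D)`" (`imageLimit_of_modulus`, two-ε); the exact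
quarter-turn symmetry makes `Ψ = Φ⁻¹ R Φ = (0, -r₂/r₁; r₁/r₂, 0)` a covariance of the SLE(8/3) law
family (`stub_conjugateRotationCovariance`); linear pinning over stretch rigidity forces
`-r₂/r₁ = -r₁/r₂`, i.e. `r₁ = r₂` (`stub_linearPinning`); so `Φ` is the similarity `z ↦ r₁ z` and
`stub_similarityIdentification` concludes.
-/

noncomputable section

namespace Summit.CriticalPhenomena.SAWScalingLimit.Cruxes.HexTransfer.PinTheShear

open MeasureTheory Filter Topology Set
open scoped NNReal
open Literature.Probability.RandomPlanarGeometry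
open Literature.Probability.LatticeModels (Site HexVertex hexGraph hexCenter)
open Literature.Probability (Process.preWienerMeasure)
open Summit.CriticalPhenomena.SAWScalingLimit.Theses

/-- The diagonal map `(x, y) ↦ (r₁ x, r₂ y)` (`r₁, r₂ > 0`) exists as a homeomorphism of the plane,
with the displayed inverse. [folklore] -/
theorem exists_diag_homeomorph {r₁ r₂ : ℝ} (h₁ : 0 < r₁) (h₂ : 0 < r₂) :
    ∃ Φ : ℂ ≃ₜ ℂ, (∀ z : ℂ, Φ z = ((r₁ * z.re : ℝ) : ℂ) + ((r₂ * z.im : ℝ) : ℂ) * Complex.I) ∧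
      ∀ z : ℂ, Φ.symm z = ((r₁⁻¹ * z.re : ℝ) : ℂ) + ((r₂⁻¹ * z.im : ℝ) : ℂ) * Complex.I := by
  have h10 : r₁ ≠ 0 := h₁.ne'
  have h20 : r₂ ≠ 0 := h₂.ne'
  refine ⟨{ toFun := fun z => ((r₁ * z.re : ℝ) : ℂ) + ((r₂ * z.im : ℝ) : ℂ) * Complex.I
            invFun := fun z => ((r₁⁻¹ * z.re : ℝ) : ℂ) + ((r₂⁻¹ * z.im : ℝ) : ℂ) * Complex.I
            left_inv := fun z => ?_
            right_inv := fun z => ?_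
            continuous_toFun := by fun_prop
            continuous_invFun := by fun_prop }, fun z => rfl, fun z => rfl⟩
  · apply Complex.ext <;> simp [h10, h20]
  · apply Complex.ext <;> simp [h10, h20]

/-- **Image limit from linear-modulus universality** (two-ε): under `HexConjecture`, the transport
clause of `ModulusUniversality` for a homeomorphism `Φ` gives, for every Dobrushin domain `D` and
every `ℤ²` endpoint approximation, convergence in law of the critical `δℤ²` SAW law to `Φ ∘ Γ`
with `Γ` an SLE(8/3) random curve of `Φ⁻¹(D)`. [folklore] -/
theorem imageLimit_of_modulus (hH : SAWBrickWallHomotopy.HexConjecture) {Φ : ℂ ≃ₜ ℂ}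
    (hT : ∀ (D : DobrushinDomain) (a b : ℝ → Site 2), SAW.IsEndpointApprox D a b →
      ∃ a' b' : ℝ → HexVertex,
        SAW.IsEmbEndpointApprox hexGraph hexCenter (D.map Φ.symm) a' b' ∧
        ∀ f : BoundedContinuousFunction (CurveClass ℂ) ℝ,
          Tendsto (fun δ => (∫ γ, f γ.curve ∂(SAW.law D.carrier δ (a δ) (b δ))) -
            ∫ γ, f (CurveClass.map (Φ : C(ℂ, ℂ)) γ.curve)
              ∂(SAW.hexSAWLaw (D.map Φ.symm).carrier δ (a' δ) (b' δ)))
            (𝓝[>] 0) (𝓝 0)) :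
    ∀ (D : DobrushinDomain) (a b : ℝ → Site 2), SAW.IsEndpointApprox D a b →
      ∃ Γ : (ℝ≥0 → ℝ) → CurveClass ℂ, IsSLECurve ((8 : ℝ≥0) / 3) (D.map Φ.symm) Γ ∧
        TendstoLaw (fun δ (γ : SAW.DomainSAW D.carrier δ (a δ) (b δ)) => γ.curve)
          (fun δ => SAW.law D.carrier δ (a δ) (b δ))
          (fun ω => CurveClass.map (Φ : C(ℂ, ℂ)) (Γ ω)) Process.preWienerMeasure := by
  intro D a b hab
  obtain ⟨a', b', hab', hdiff⟩ := hT D a b hab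
  obtain ⟨Γ, hΓ, -, hlim⟩ := hH (D.map Φ.symm) a' b' hab'
  refine ⟨Γ, hΓ, fun f => ?_⟩
  set g : C(CurveClass ℂ, CurveClass ℂ) := ⟨CurveClass.map (Φ : C(ℂ, ℂ)), CurveClass.continuous_map _⟩
    with hg
  have hf := hlim (f.compContinuous g)
  have h := (hdiff f).add hf
  rw [zero_add] at h
  refine h.congr fun δ => ?_
  simp only [BoundedContinuousFunction.compContinuous_apply, hg, ContinuousMap.coe_mk]
  ring

/-- **The Assembly of route SAWBrickWallHomotopy** (item stmt-CriticalPhenomena-10313):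
`HexConjecture → ModulusUniversality → StretchRigidity → QuarterTurnCovariance → SAWScalingLimit`.
[folklore] -/
theorem brickWall_assembly : SAWBrickWallHomotopy.Assembly := by
  intro hH hMU hS hQ
  obtain ⟨r₁, r₂, h₁, h₂, hMU'⟩ := hMU
  obtain ⟨Φ, hΦ, hΦsymm⟩ := exists_diag_homeomorph h₁ h₂
  have hIL := imageLimit_of_modulus hH (hMU' Φ hΦ)
  -- `Ψ = Φ⁻¹ R Φ` is a covariance of the SLE(8/3) family
  have hcov := stub_conjugateRotationCovariance Φ hIL hQ
  -- `Ψ` is the linear map `(0, -r₂/r₁; r₁/r₂, 0)`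
  have hΨ : ∀ z : ℂ, (Φ.trans ((similarity Complex.I Complex.I_ne_zero 0).trans Φ.symm)) z =
      ((0 * z.re + -(r₂ / r₁) * z.im : ℝ) : ℂ) + ((r₁ / r₂ * z.re + 0 * z.im : ℝ) : ℂ) * Complex.I := by
    intro z
    rw [Homeomorph.trans_apply, Homeomorph.trans_apply, similarity_apply, add_zero, hΦsymm, hΦ]
    apply Complex.ext
    · simp
      ring
    · simp
      ring
  have hdet : 0 < 0 * 0 - -(r₂ / r₁) * (r₁ / r₂) := by
    have : -(r₂ / r₁) * (r₁ / r₂) = -1 := by field_simp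
    rw [this]
    norm_num
  obtain ⟨-, h12⟩ := stub_linearPinning hS 0 (-(r₂ / r₁)) (r₁ / r₂) 0 hdet _ hΨ hcov
  -- hence `r₁ = r₂`, and `Φ` is the similarity `z ↦ r₁ z`
  have hr : r₁ = r₂ := by
    have h : r₂ / r₁ = r₁ / r₂ := by linarith
    rw [div_eq_div_iff h₁.ne' h₂.ne'] at h
    nlinarith [h₁, h₂]
  subst hr
  have hc : (r₁ : ℂ) ≠ 0 := Complex.ofReal_ne_zero.2 h₁.ne'
  have hΦeq : Φ = similarity (r₁ : ℂ) hc 0 := by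
    ext1 z
    rw [hΦ, similarity_apply, add_zero]
    apply Complex.ext <;> simp
  subst hΦeq
  exact stub_similarityIdentification (r₁ : ℂ) hc hIL

end Summit.CriticalPhenomena.SAWScalingLimit.Cruxes.HexTransfer.PinTheShear

end
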